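import Literature.Topology.FourManifolds.SubmersionStraightening
import Literature.Topology.FourManifolds.ComplementConnected
import HarnessLib

/-!
# Small neighbourhoods of a regular point with connected fibre complement

Topic `Literature/Topology/FourManifolds` (local lemma for the connectedness of the regular fibre of
a Lefschetz fibration, fact seat `provefact-Literature.Geometry.Symplectic.Oba2016_s-add47373d4`).  Let
`f : M → ℝ²` be smooth on a `4`-manifold with boundary and `z` an interior point at which `df_z`
is onto.  Then `z` has arbitrarily small neighbourhoods `N` such that `N \ f⁻¹(f z)` is
preconnected: in a straightening chart (`Literature.Topology.FourManifolds.exists_straighteningChart`) the fibre through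
`z` is a linear subspace of codimension `2` of `ℝ⁴`, and a ball minus such a subspace is
preconnected (`Literature.Topology.FourManifolds.isPreconnected_ball_diff_vadd_submodule`).

* `rank_quotient_ker_sndFibreCoord` — the subspace `{q | ((appendCLE)⁻¹ q).2 = 0}` of `ℝ⁴` has
  codimension `2`;
* `exists_nhds_subset_isPreconnected_diff_fibre` — the local lemma.

Everything is proved; no definitions, no named facts.

## References

* M. W. Hirsch, *Differential Topology*, GTM 33 (1976), Ch. 1 §3, Thm. 3.2. [HirschDT1976]
-/

open scoped Manifold ContDiff Topology
open Set Function Filter Metric Module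

noncomputable section

namespace Literature.Topology.FourManifolds

/-! ### §1 The model fibre has codimension two -/

/-- The linear map `q ↦ ((appendCLE hab)⁻¹ q).2 : ℝ⁴ → ℝ²` is onto, so its kernel — the model
fibre `{q | ((appendCLE hab)⁻¹ q).2 = 0}` — has codimension `2 > 1`. [folklore] -/
theorem one_lt_rank_quotient_ker_snd_comp_appendCLE_symm (hab : 2 + 2 = 4) :
    1 < Module.rank ℝ (EuclideanSpace ℝ (Fin 4) ⧸ LinearMap.ker
      ((LinearMap.snd ℝ (EuclideanSpace ℝ (Fin 2)) (EuclideanSpace ℝ (Fin 2))).comp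
        ((appendCLE hab).symm : EuclideanSpace ℝ (Fin 4) ≃L[ℝ]
          (EuclideanSpace ℝ (Fin 2) × EuclideanSpace ℝ (Fin 2))).toLinearEquiv.toLinearMap)) := by
  set Λ := (LinearMap.snd ℝ (EuclideanSpace ℝ (Fin 2)) (EuclideanSpace ℝ (Fin 2))).comp
    ((appendCLE hab).symm : EuclideanSpace ℝ (Fin 4) ≃L[ℝ]
      (EuclideanSpace ℝ (Fin 2) × EuclideanSpace ℝ (Fin 2))).toLinearEquiv.toLinearMap with hΛ
  have hsurj : Surjective Λ := by
    intro w
    refine ⟨appendCLE hab (0, w), ?_⟩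
    show ((appendCLE hab).symm (appendCLE hab (0, w))).2 = w
    rw [ContinuousLinearEquiv.symm_apply_apply]
  have e := Λ.quotKerEquivOfSurjective hsurj
  rw [e.rank_eq, ← Module.finrank_eq_rank, finrank_euclideanSpace_fin]
  norm_num

/-! ### §2 The local lemma -/

variable {M : Type*} [TopologicalSpace M] [ChartedSpace (EuclideanHalfSpace 4) M]
  [IsManifold (𝓡∂ 4) ∞ M]

/-- **Small neighbourhoods of an interior regular point with connected fibre complement.**  If
`f : M → ℝ²` is smooth, `z` is an interior point and `df_z` is onto, then inside every
neighbourhood `U` of `z` there is a neighbourhood `N` of `z` with `N \ f⁻¹(f z)` preconnected.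
[cite: HirschDT1976, Ch. 1 §3, Thm. 3.2] -/
theorem exists_nhds_subset_isPreconnected_diff_fibre {f : M → EuclideanSpace ℝ (Fin 2)}
    (hf : ContMDiff (𝓡∂ 4) 𝓘(ℝ, EuclideanSpace ℝ (Fin 2)) ∞ f) {z : M}
    (hz : (𝓡∂ 4).IsInteriorPoint z)
    (hsurj : Surjective (mfderiv (𝓡∂ 4) 𝓘(ℝ, EuclideanSpace ℝ (Fin 2)) f z))
    {U : Set M} (hU : U ∈ 𝓝 z) :
    ∃ N ∈ 𝓝 z, N ⊆ U ∧ IsPreconnected (N \ f ⁻¹' {f z}) := by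
  have hab : 2 + 2 = 4 := rfl
  obtain ⟨ψ, hψatlas, hzψ, hψz, hψf, hψint⟩ := exists_straighteningChart hab hf hz hsurj
    (EuclideanSpace.single (0 : Fin 2) (1 : ℝ)) (appendCLE_single_zero_mem_interior_range hab)
  set I := (𝓡∂ 4) with hI
  set χ := ψ.extend I with hχ
  set q₀ : EuclideanSpace ℝ (Fin 4) := I (ψ z) with hq₀
  have hχz : χ z = q₀ := rfl
  have hzsrc : z ∈ χ.source := by rw [hχ, ψ.extend_source]; exact hzψ
  -- an open set of model points over which `χ⁻¹` is defined
  set T : Set (EuclideanSpace ℝ (Fin 4)) := I.symm ⁻¹' ψ.target ∩ interior (range I) with hT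
  have hTopen : IsOpen T := (ψ.open_target.preimage I.continuous_symm).inter isOpen_interior
  have hq₀T : q₀ ∈ T := by
    refine ⟨?_, hψint z hzψ⟩
    show I.symm (I (ψ z)) ∈ ψ.target
    rw [I.left_inv]; exact ψ.map_source hzψ
  have hTsub : T ⊆ χ.target := by
    rintro q ⟨hq, hq'⟩
    rw [hχ, ψ.extend_target]
    exact ⟨hq, interior_subset hq'⟩
  -- `χ⁻¹` is continuous on the target and maps `q₀` to `z`
  have hsymm_cont : ContinuousOn χ.symm χ.target := ψ.continuousOn_extend_symm
  have hsymm_q₀ : χ.symm q₀ = z := by rw [← hχz]; exact ψ.extend_left_inv (I := I) hzψ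
  -- choose a small ball
  have h1 : ∀ᶠ q in 𝓝 q₀, q ∈ T := hTopen.mem_nhds hq₀T
  have h2 : ∀ᶠ q in 𝓝[χ.target] q₀, χ.symm q ∈ U := by
    have hc : ContinuousWithinAt χ.symm χ.target q₀ := hsymm_cont q₀ (hTsub hq₀T)
    rw [ContinuousWithinAt, hsymm_q₀] at hc
    exact hc hU
  obtain ⟨ε, hε, hball⟩ : ∃ ε > 0, ball q₀ ε ⊆ T ∧ ∀ q ∈ ball q₀ ε, χ.symm q ∈ U := by
    obtain ⟨ε₁, hε₁, h1'⟩ := Metric.eventually_nhds_iff_ball.1 h1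
    obtain ⟨ε₂, hε₂, h2'⟩ := Metric.mem_nhdsWithin_iff.1 h2
    refine ⟨min ε₁ ε₂, lt_min hε₁ hε₂, fun q hq => h1' q (ball_subset_ball (min_le_left _ _) hq),
      fun q hq => h2' ⟨ball_subset_ball (min_le_right _ _) hq, hTsub (h1' q ?_)⟩⟩
    exact ball_subset_ball (min_le_left _ _) hq
  obtain ⟨hballT, hballU⟩ := hball
  set N : Set M := χ.symm '' ball q₀ ε with hN
  -- `N` is a neighbourhood of `z` inside `U`
  have hNeq : N = χ.source ∩ χ ⁻¹' ball q₀ ε :=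
    χ.symm_image_eq_source_inter_preimage (hballT.trans hTsub |>.trans le_rfl)
  have hNnhds : N ∈ 𝓝 z := by
    rw [hNeq]
    have hopen : IsOpen (χ.source ∩ χ ⁻¹' ball q₀ ε) := ψ.isOpen_extend_preimage' isOpen_ball
    exact hopen.mem_nhds ⟨hzsrc, by rw [mem_preimage, hχz]; exact mem_ball_self hε⟩
  have hNU : N ⊆ U := by
    rintro x ⟨q, hq, rfl⟩
    exact hballU q hq
  refine ⟨N, hNnhds, hNU, ?_⟩
  -- the fibre read in the chart is the kernel of `q ↦ ((appendCLE)⁻¹ q).2`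
  set K : Submodule ℝ (EuclideanSpace ℝ (Fin 4)) := LinearMap.ker
    ((LinearMap.snd ℝ (EuclideanSpace ℝ (Fin 2)) (EuclideanSpace ℝ (Fin 2))).comp
      ((appendCLE hab).symm : EuclideanSpace ℝ (Fin 4) ≃L[ℝ]
        (EuclideanSpace ℝ (Fin 2) × EuclideanSpace ℝ (Fin 2))).toLinearEquiv.toLinearMap) with hK
  have hmemK : ∀ q : EuclideanSpace ℝ (Fin 4), q ∈ K ↔ ((appendCLE hab).symm q).2 = 0 := fun q =>
    Iff.rfl
  have hq₀K : q₀ ∈ K := by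
    rw [hmemK]
    show ((appendCLE hab).symm q₀).2 = 0
    rw [hψz, ContinuousLinearEquiv.symm_apply_apply]
  have hfibre : ∀ q ∈ ball q₀ ε, (χ.symm q ∈ f ⁻¹' {f z} ↔ q - q₀ ∈ K) := by
    intro q hq
    have hqT := hballT hq
    have hqt : q ∈ χ.target := hTsub hqT
    have hsrc : χ.symm q ∈ ψ.source := by
      rw [← ψ.extend_source (I := I)]; exact χ.map_target hqt
    have hχq : I (ψ (χ.symm q)) = q := χ.right_inv hqt
    have h := hψf (χ.symm q) hsrc
    rw [hχq] at h
    rw [K.sub_mem_iff_left hq₀K, hmemK, h, mem_preimage, mem_singleton_iff, sub_eq_zero]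
  have himage : N \ f ⁻¹' {f z} = χ.symm '' (ball q₀ ε \ {q | q - q₀ ∈ K}) := by
    ext x
    constructor
    · rintro ⟨⟨q, hq, rfl⟩, hx⟩
      exact ⟨q, ⟨hq, fun h => hx ((hfibre q hq).2 h)⟩, rfl⟩
    · rintro ⟨q, ⟨hq, hqK⟩, rfl⟩
      exact ⟨⟨q, hq, rfl⟩, fun h => hqK ((hfibre q hq).1 h)⟩
  rw [himage]
  exact (isPreconnected_ball_diff_vadd_submodule
    (one_lt_rank_quotient_ker_snd_comp_appendCLE_symm hab) q₀ hε).image χ.symm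
      (hsymm_cont.mono (Set.sdiff_subset.trans (hballT.trans hTsub)))

end Literature.Topology.FourManifolds

end
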